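import Summits.AtomisticToContinuum.Crystallization.Theorems.FluxTubeKeplerFloorGivesLayered
import Summits.AtomisticToContinuum.Crystallization.Theorems.FluxTubeKeplerFluxCellKeplerSingleScale

/-!
# `FirstShellRung` — SPECIAL-CASE file (F3): the family `RadiusRung 𝓡` specialises to the proved floor

Self-contained, sorry-free copy (namespace `…RadiusLadder.Special`) of the graded family of
`Lines/FirstShellRung.lean` with its two DECIDED members:
* `radiusRung_univ : RadiusRung Set.univ` — the floor `FluxTubeKepler.FloorGivesLayered`
  (`Theorems.FluxTubeKeplerFloorGivesLayered.FloorGivesLayered_proof`, seed g1-AtomisticToContinuum-15223)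
  followed by the proved `PeriodicGivenLayered`;
* `radiusRung_two : RadiusRung {2}` — the ladder's second rung, from the landed potential-free chart
  gluing at radius `2` (`FluxCellKeplerSingleScale.card_bad_le`) and `LennardJonesMinimalDistance_holds`.
The deciding rung `FirstShellRung := RadiusRung {6/5}` is the member NOT decided here.
-/

noncomputable section

open scoped BigOperators Classical
open Filter Topology

namespace Summit.AtomisticToContinuum.Crystallization.Cruxes.FluxCellKepler.RadiusLadder.Special

open Literature.MathematicalPhysics.StatisticalMechanics
open Summit.AtomisticToContinuum.Crystallization.Theorems.FluxCellKeplerSingleScale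
  (LayeredGood layeredGood_mono card_bad_le SingleScaleFluxCellKepler fluxCellKepler_of_singleScale
    singleScale_of_fluxCellKepler)
open Summit.AtomisticToContinuum.Crystallization.Theorems.PrestressSplitKorn
  (squeeze_card_filter_exists_near_le)

local notation "E3" => EuclideanSpace ℝ (Fin 3)

/-! ## The graded family -/

/-- FLOOR(P₀): `N · e(P₀) ≤ E(x)` for every Lennard-Jones ground state `x` of every size `N`
(verbatim the first hypothesis of `FluxTubeKepler.FloorGivesLayered`; same text as
`ToleranceLadder.Floor`, `VacancyLadder.Floor`). -/
def Floor (P₀ : PeriodicConfiguration 3) : Prop :=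
  ∀ (N : ℕ) (x : Fin N → E3), IsGroundState lennardJones x →
    (N : ℝ) * P₀.energyPerParticle lennardJones ≤ interactionEnergy lennardJones x

/-- BUDGET(P₀) ON THE RADIUS SET `𝓡`: for every pattern radius `R ∈ 𝓡`, `R > 0`, and every tolerance
`η > 0`, some `c > 0` prices the `(R,η)`-non-layered sites of every Lennard-Jones ground state against the
excess energy over `N · e(P₀)` (`LayeredGood` is the crux's defect predicate, verbatim; `𝓡 = univ` is the
floor's budget at every radius). -/
def Budget (𝓡 : Set ℝ) (P₀ : PeriodicConfiguration 3) : Prop :=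
  ∀ R η : ℝ, 0 < R → R ∈ 𝓡 → 0 < η → ∃ c : ℝ, 0 < c ∧
    ∀ (N : ℕ) (x : Fin N → E3), IsGroundState lennardJones x →
      c * (Nat.card {i : Fin N // ¬ LayeredGood R η x i} : ℝ) ≤
        interactionEnergy lennardJones x - (N : ℝ) * P₀.energyPerParticle lennardJones

/-- Periodic windows at every scale along the sequence `x` (ONE periodic `P`, translations only) —
verbatim the conclusion of `ChessboardParticlePlanes.PeriodicWindows` / `FluxTubeKepler.PeriodicGivenLayered`. -/
def HasPeriodicWindows (x : (N : ℕ) → (Fin N → E3)) : Prop :=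
  ∃ P : PeriodicConfiguration 3, ∀ R ε : ℝ, 0 < ε → ∃ᶠ N in atTop, ∃ t : E3,
    (∀ s ∈ P.points, ‖s‖ ≤ R → ∃ i : Fin N, dist (x N i + t) s ≤ ε) ∧
    (∀ i : Fin N, ‖x N i + t‖ ≤ R → ∃ s ∈ P.points, dist (x N i + t) s ≤ ε)

/-- **The graded family.** `RadiusRung 𝓡`: FLOOR and the defect budget at the radii in `𝓡` (all
tolerances) force periodic windows along every Lennard-Jones ground-state sequence. -/
def RadiusRung (𝓡 : Set ℝ) : Prop :=
  ∀ P₀ : PeriodicConfiguration 3, Floor P₀ → Budget 𝓡 P₀ →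
    ∀ x : (N : ℕ) → (Fin N → E3), (∀ N, IsGroundState lennardJones (x N)) → HasPeriodicWindows x

/-- **Deciding rung.** The defect budget at the coordination-shell radius `6/5` alone suffices. -/
def FirstShellRung : Prop := RadiusRung {6 / 5}

/-! ## F3 — the family specialises to the proved floor -/

/-- `RadiusRung univ` is the floor: the seed theorem followed by the proved `PeriodicGivenLayered`. -/
theorem radiusRung_univ : RadiusRung Set.univ := fun P₀ hF hB x hx =>
  Theses.FluxTubeKepler.PeriodicGivenLayered_holds x hx
    (Theorems.FluxTubeKeplerFloorGivesLayered.FloorGivesLayered_proof P₀ hF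
      (fun R η hR hη => hB R η hR (Set.mem_univ R) hη) x hx)

/-! ## Dial monotonicity (fewer radii assumed = stronger statement) -/

/-- `Budget` is monotone in the radius set (as a hypothesis). -/
theorem budget_anti {𝓡 𝓡' : Set ℝ} (h : 𝓡 ⊆ 𝓡') {P₀ : PeriodicConfiguration 3} :
    Budget 𝓡' P₀ → Budget 𝓡 P₀ :=
  fun hB R η hR hR𝓡 hη => hB R η hR (h hR𝓡) hη

/-- `RadiusRung` is monotone: a rung assuming the budget at fewer radii implies every rung assuming it
at more. -/
theorem radiusRung_mono {𝓡 𝓡' : Set ℝ} (h : 𝓡 ⊆ 𝓡') : RadiusRung 𝓡 → RadiusRung 𝓡' :=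
  fun H P₀ hF hB x hx => H P₀ hF (budget_anti h hB) x hx

/-- Every rung gives back the floor (informational `specialises`). -/
theorem radiusRung_univ_of (𝓡 : Set ℝ) (h : RadiusRung 𝓡) : RadiusRung Set.univ :=
  radiusRung_mono (Set.subset_univ 𝓡) h

/-- Radius monotonicity of the defect predicate inside one budget: the budget at a radius `ρ` gives the
budget at every radius `R ≤ ρ` with the same constant (`layeredGood_mono`). -/
theorem budget_Ioc_of_singleton {ρ : ℝ} {P₀ : PeriodicConfiguration 3} (hB : Budget {ρ} P₀) :
    Budget (Set.Ioc 0 ρ) P₀ := by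
  intro R η hR hRρ hη
  obtain ⟨c, hc, hcb⟩ := hB ρ η (hR.trans_le hRρ.2) rfl hη
  refine ⟨c, hc, fun N x hx => ?_⟩
  have hmono : (Nat.card {i : Fin N // ¬ LayeredGood R η x i} : ℝ) ≤
      Nat.card {i : Fin N // ¬ LayeredGood ρ η x i} := by
    have hle : Nat.card {i : Fin N // ¬ LayeredGood R η x i} ≤
        Nat.card {i : Fin N // ¬ LayeredGood ρ η x i} := by
      rw [Nat.card_eq_fintype_card, Nat.card_eq_fintype_card]
      exact Fintype.card_subtype_mono _ _ fun i hi hg => hi (layeredGood_mono hRρ.2 x i hg)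
    exact_mod_cast hle
  exact (mul_le_mul_of_nonneg_left hmono hc.le).trans (hcb N x hx)

/-! ## Counting: from a chart-gluing statement to a defect-count inequality -/

/-- **Counting form of a gluing.**  If every `δ`-separated configuration glues — a site all of whose
neighbours within `R'` are `(R₀,η')`-good is `(R,η)`-good — then `#bad_(R,η) ≤ (2ρ/δ+1)³ · #bad_(R₀,η')`,
`ρ = max R' 0` (the pattern of `FluxCellKeplerSingleScale.card_bad_le`, with the gluing abstracted). -/
theorem card_bad_le_of_gluing {δ : ℝ} (hδ : 0 < δ) {R₀ η' R η R' : ℝ}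
    (hglue : ∀ (N : ℕ) (x : Fin N → E3), (∀ i j : Fin N, i ≠ j → δ ≤ dist (x i) (x j)) →
      ∀ i : Fin N, (∀ j : Fin N, dist (x j) (x i) ≤ R' → LayeredGood R₀ η' x j) → LayeredGood R η x i) :
    ∀ (N : ℕ) (x : Fin N → E3), (∀ i j : Fin N, i ≠ j → δ ≤ dist (x i) (x j)) →
      (Nat.card {i : Fin N // ¬ LayeredGood R η x i} : ℝ) ≤
        (2 * max R' 0 / δ + 1) ^ 3 * Nat.card {i : Fin N // ¬ LayeredGood R₀ η' x i} := by
  intro N x hsep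
  set ρ : ℝ := max R' 0 with hρ
  set D := Finset.univ.filter fun j : Fin N => ¬ LayeredGood R₀ η' x j with hD
  set B := Finset.univ.filter fun i : Fin N => ∃ j ∈ D, dist (x j) (x i) ≤ ρ with hB
  have hBle : (B.card : ℝ) ≤ (2 * ρ / δ + 1) ^ 3 * D.card :=
    squeeze_card_filter_exists_near_le hδ (le_max_right _ _) hsep D
  have hbadB : Nat.card {i : Fin N // ¬ LayeredGood R η x i} ≤ B.card := by
    have hle : Nat.card {i : Fin N // ¬ LayeredGood R η x i} ≤ Nat.card {i : Fin N // i ∈ B} := by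
      rw [Nat.card_eq_fintype_card, Nat.card_eq_fintype_card]
      refine Fintype.card_subtype_mono _ _ fun i hi => ?_
      by_contra hiB
      refine hi (hglue N x hsep i fun j hj => ?_)
      by_contra hjD
      exact hiB (Finset.mem_filter.2 ⟨Finset.mem_univ _, j,
        Finset.mem_filter.2 ⟨Finset.mem_univ _, hjD⟩, hj.trans (le_max_left _ _)⟩)
    rwa [Nat.card_eq_finsetCard] at hle
  have hDcard : (D.card : ℝ) = Nat.card {i : Fin N // ¬ LayeredGood R₀ η' x i} := by
    rw [Nat.card_eq_fintype_card, Fintype.card_subtype]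
  calc (Nat.card {i : Fin N // ¬ LayeredGood R η x i} : ℝ) ≤ B.card := by exact_mod_cast hbadB
    _ ≤ (2 * ρ / δ + 1) ^ 3 * D.card := hBle
    _ = (2 * ρ / δ + 1) ^ 3 * Nat.card {i : Fin N // ¬ LayeredGood R₀ η' x i} := by rw [hDcard]

/-- Transport of a budget along a count inequality on ground states: if `#bad_(R,η) ≤ M·#bad_(R₀,η')` on
every ground state and `c` prices `(R₀,η')`-defects, then `c/M` prices `(R,η)`-defects. -/
theorem price_of_count {P₀ : PeriodicConfiguration 3} {R η R₀ η' M c : ℝ} (hM : 0 < M) (hc : 0 < c)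
    (hcount : ∀ (N : ℕ) (x : Fin N → E3), IsGroundState lennardJones x →
      (Nat.card {i : Fin N // ¬ LayeredGood R η x i} : ℝ) ≤
        M * Nat.card {i : Fin N // ¬ LayeredGood R₀ η' x i})
    (hcb : ∀ (N : ℕ) (x : Fin N → E3), IsGroundState lennardJones x →
      c * (Nat.card {i : Fin N // ¬ LayeredGood R₀ η' x i} : ℝ) ≤
        interactionEnergy lennardJones x - (N : ℝ) * P₀.energyPerParticle lennardJones) :
    ∀ (N : ℕ) (x : Fin N → E3), IsGroundState lennardJones x →
      c / M * (Nat.card {i : Fin N // ¬ LayeredGood R η x i} : ℝ) ≤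
        interactionEnergy lennardJones x - (N : ℝ) * P₀.energyPerParticle lennardJones := by
  intro N x hx
  have h1 := hcount N x hx
  have h2 := hcb N x hx
  have h3 : c / M * (Nat.card {i : Fin N // ¬ LayeredGood R η x i} : ℝ) ≤
      c * Nat.card {i : Fin N // ¬ LayeredGood R₀ η' x i} := by
    calc c / M * (Nat.card {i : Fin N // ¬ LayeredGood R η x i} : ℝ)
        ≤ c / M * (M * Nat.card {i : Fin N // ¬ LayeredGood R₀ η' x i}) :=
          mul_le_mul_of_nonneg_left h1 (div_pos hc hM).le
      _ = c * Nat.card {i : Fin N // ¬ LayeredGood R₀ η' x i} := by field_simp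
  exact h3.trans h2

/-! ## The landed second rung: `RadiusRung {2}` -/

/-- The budget at radius `2` (all tolerances) gives the budget at every radius: for `R ≤ 2` by
`budget_Ioc_of_singleton`, for `R > 2` by the landed potential-free gluing-and-counting
`FluxCellKeplerSingleScale.card_bad_le` on ground states, which are `1/3`-separated
(`LennardJonesMinimalDistance_holds`).  No `sorry`. -/
theorem budget_univ_of_two {P₀ : PeriodicConfiguration 3} (hB : Budget {2} P₀) : Budget Set.univ P₀ := by
  intro R η hR _ hη
  by_cases hR2 : R ≤ 2
  · exact budget_Ioc_of_singleton hB R η hR ⟨hR, hR2⟩ hη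
  · obtain ⟨δ, hδ, hsep⟩ := LennardJonesMinimalDistance_holds
    obtain ⟨η', hη', M, hM, hcount⟩ := card_bad_le (le_refl (2 : ℝ)) hδ R η hη
    obtain ⟨c, hc, hcb⟩ := hB 2 η' two_pos rfl hη'
    exact ⟨c / M, div_pos hc hM,
      price_of_count hM hc (fun N x hx => hcount N x (hsep N x hx)) hcb⟩

/-- **`RadiusRung {2}` is a theorem** (the ladder's second rung, decided by landed inputs only). -/
theorem radiusRung_two : RadiusRung {2} := fun P₀ hF hB x hx =>
  radiusRung_univ P₀ hF (budget_univ_of_two hB) x hx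


end Summit.AtomisticToContinuum.Crystallization.Cruxes.FluxCellKepler.RadiusLadder.Special

end
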